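import Summits.BirchSwinnertonDyer.BirchSwinnertonDyer.Theses.UniversalToricDescent
import Summits.BirchSwinnertonDyer.BirchSwinnertonDyer.Theorems.UniversalToricDescentWildSplitWaldspurgerAtThreeOfFrame
import HarnessLib

/-!
# Route `UniversalToricDescent`: glue item `WildSplitWaldspurgerAtThreeOfFrame`
# (stmt-BirchSwinnertonDyer-20929, glue of the rev-20 split of crux #4 `WildSplitWaldspurgerAtThree` 20385) — CLOSED

Seat `bsd-wall-utd-p2` g3. The glue item says
`WildSplitFrameAtThree → LiuZhangZhangAdditiveInput → WildSplitWaldspurgerAtThree`: the frame child (#4d: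
some `ι′` inducing `𝔭` and an `R₀`-frame with `IsBDPLFunction` for `Dt.f` at the wild split `3`) and the
published Liu–Zhang–Zhang additive input imply crux #4. This is one application of the tree theorem
`UniversalToricDescentWaldspurgerFlat.wildSplitWaldspurgerAtThree_of_lzz_of_frame` (p541741, kmc g19), whose two
hypotheses are the children verbatim (the VALUE half `Q(𝟙) = u·(log_ω P/c)²`, `‖u‖ = 1`, is the tree theorem
`wildSplitWaldspurgerAtThree_flat`, p540475, consumed inside it). Split kit: pub/bsd-potss/bsd-potss-kmc/g19/split-B.
`--workitem stmt-BirchSwinnertonDyer-20929`.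
-/

noncomputable section

set_option linter.dupNamespace false
set_option autoImplicit false

namespace Summit.BirchSwinnertonDyer.BirchSwinnertonDyer.Theorems

/-- **Glue `WildSplitWaldspurgerAtThreeOfFrame` (item 20929) holds**: frame child #4d ∧ LZZ additive input
⟹ crux #4 `WildSplitWaldspurgerAtThree`, by
`UniversalToricDescentWaldspurgerFlat.wildSplitWaldspurgerAtThree_of_lzz_of_frame` (p541741). -/
theorem wildSplitWaldspurgerAtThreeOfFrame_proof :
    Summit.BirchSwinnertonDyer.BirchSwinnertonDyer.Theses.UniversalToricDescent.WildSplitWaldspurgerAtThreeOfFrame := by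
  intro hE hL
  exact UniversalToricDescentWaldspurgerFlat.wildSplitWaldspurgerAtThree_of_lzz_of_frame hL hE

end Summit.BirchSwinnertonDyer.BirchSwinnertonDyer.Theorems

end
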